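import Literature.Computability.Learning.NaturalLearningRun
import Literature.Computability.Learning.NWDesignFP
import Literature.Computability.Complexity.StackWordArith
import HarnessLib

/-!
# Steps towards `cikk_natural_implies_learning`: the tables of the NW predictor (column designs)

Ninth instalment of the decomposition of the named fact
`Literature.Computability.Learning.cikk_natural_implies_learning` (CIKK 2016, Thm. 5.1): the
mathematical model of the TABLES with which the hypothesis evaluator computes the NW predictor
(CIKK §2.4, NW reconstruction algorithm, preprocessing step 4 and circuit-construction step 2:
"for each `j < i`, enumerate all `x` consistent with the partial assignment, query `f`, build
the table `T`; … fix the `j`th input of `D` to `w_j = f(z|_{S_j})` via table lookup").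

For the learner's design (`learnerDesign`, the graphs of the polynomials `A_v` over `𝔽_q` on the
columns `τ < n'`), two blocks meet only in COMMON COLUMNS: `e j τ ∈ S_i` iff
`A_i(τ) ≡ A_j(τ) (mod q)` (`colMatch`), and then `e j τ = e i τ`. Hence the restriction of the
completed seed `z' = x ∪ z|_{S_iᶜ}` to block `j` is `mixInput i j z x : τ ↦ x τ` on matching
columns, `z (e j τ)` elsewhere (`extend_comp_eq_mixInput`); it depends on `x` only through the
pattern `(x τ)_{τ matching}`, read as a number `idxOf i j x < 2^{#matching} ≤ 2^ℓ = L`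
(`card_matching_le`: a design property), and the table of block `j`
(`tableList i j z`, the `2^{#matching}` values of `AMP(f)` on the patterns, `patInput`) returns
`AMP(f)(z'|_{S_j})` at that index (`tableList_getElem_idxOf`). Consequently the NW predictor is a
function of the tables, `w`, `i` and the matching bits of `x` (`nwPredictor_eq_ofTables`).

## References

* M. Carmosino, R. Impagliazzo, V. Kabanets, A. Kolokolova, *Learning algorithms from natural
  proofs*, CCC 2016, §2.4 (NW reconstruction algorithm), §3.1 [CarmosinoImpagliazzoKabanetsKolokolova2016].
-/

namespace Literature.Computability.Learning

open Literature.Computability.Complexity Literature.Computability.MetaComplexity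
  Literature.Computability.Cryptography _root_.Computability Finset

section Tables

variable {q n k ℓ : ℕ} [Fact q.Prime] (hn : k * n + k ≤ q)

/-- The column value `A_i(τ) mod q` of block `i` at column `τ`. [cite: CarmosinoImpagliazzoKabanetsKolokolova2016, §3.1] -/
def colVal (q ℓ : ℕ) (i : Fin (2 ^ ℓ)) (τ : ℕ) : ℕ :=
  polyValNat ℓ (List.ofFn ((boolFunEquivFin ℓ).symm i)) τ % q

/-- Blocks `i` and `j` **match in column `τ`**: `A_i(τ) ≡ A_j(τ) (mod q)`. [folklore] -/
def colMatch (q ℓ : ℕ) (i j : Fin (2 ^ ℓ)) (τ : ℕ) : Prop := colVal q ℓ i τ = colVal q ℓ j τ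

/-- `colMatch` is decidable. [folklore] -/
instance (q ℓ : ℕ) (i j : Fin (2 ^ ℓ)) (τ : ℕ) : Decidable (colMatch q ℓ i j τ) := by
  unfold colMatch; infer_instance

include hn in
/-- The position of the learner's design in column `τ`. [folklore] -/
theorem learnerDesign_val (i : Fin (2 ^ ℓ)) (τ : Fin (k * n + k)) :
    ((learnerDesign q n k ℓ hn i τ : Fin (q * q)) : ℕ) = colVal q ℓ i τ + q * τ := by
  rw [learnerDesign, cikkDesign_val]; rfl

include hn in
/-- Two design positions coincide iff they are in the same column with matching column values.
[folklore] -/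
theorem learnerDesign_eq_iff (i j : Fin (2 ^ ℓ)) (s τ : Fin (k * n + k)) :
    learnerDesign q n k ℓ hn i s = learnerDesign q n k ℓ hn j τ ↔ s = τ ∧ colMatch q ℓ i j τ := by
  have hq : 0 < q := (Fact.out : q.Prime).pos
  rw [Fin.ext_iff, learnerDesign_val hn, learnerDesign_val hn, colMatch]
  have h1 : colVal q ℓ i s < q := Nat.mod_lt _ hq
  have h2 : colVal q ℓ j τ < q := Nat.mod_lt _ hq
  constructor
  · intro h
    have hs : (s : ℕ) = τ := by
      have := congrArg (· / q) h
      simp only [Nat.add_mul_div_left _ _ hq, Nat.div_eq_of_lt h1, Nat.div_eq_of_lt h2,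
        zero_add] at this
      exact this
    obtain rfl : s = τ := Fin.ext hs
    exact ⟨rfl, Nat.add_right_cancel h⟩
  · rintro ⟨rfl, h⟩
    rw [h]

include hn in
/-- A position of block `j` lies in block `i` iff the columns match. [folklore] -/
theorem mem_range_iff_colMatch (i j : Fin (2 ^ ℓ)) (τ : Fin (k * n + k)) :
    learnerDesign q n k ℓ hn j τ ∈ Set.range (learnerDesign q n k ℓ hn i) ↔ colMatch q ℓ i j τ := by
  constructor
  · rintro ⟨s, hs⟩
    exact ((learnerDesign_eq_iff hn i j s τ).1 hs).2
  · intro h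
    exact ⟨τ, (learnerDesign_eq_iff hn i j τ τ).2 ⟨rfl, h⟩⟩

/-- **The restriction of the completed seed to block `j`**: `x` on the matching columns, `z`
elsewhere. [cite: CarmosinoImpagliazzoKabanetsKolokolova2016, §2.4 (circuit construction, steps 1–2)] -/
def mixInput (q ℓ : ℕ) {m n' : ℕ} (e : Fin (2 ^ ℓ) → (Fin n' ↪ Fin m)) (i j : Fin (2 ^ ℓ))
    (z : Fin m → Bool) (x : Fin n' → Bool) : Fin n' → Bool :=
  fun τ => if colMatch q ℓ i j τ then x τ else z (e j τ)

include hn in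
/-- `z'|_{S_j} = mixInput` for the learner's design. [folklore] -/
theorem extend_comp_eq_mixInput (i j : Fin (2 ^ ℓ)) (z : Fin (q * q) → Bool)
    (x : Fin (k * n + k) → Bool) :
    Function.extend (learnerDesign q n k ℓ hn i) x z ∘ (learnerDesign q n k ℓ hn j) =
      mixInput q ℓ (learnerDesign q n k ℓ hn) i j z x := by
  funext τ
  simp only [Function.comp_apply, mixInput]
  split_ifs with h
  · rw [← (learnerDesign_eq_iff hn i j τ τ).2 ⟨rfl, h⟩,
      (learnerDesign q n k ℓ hn i).injective.extend_apply]
  · rw [Function.extend_apply']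
    intro ⟨s, hs⟩
    exact h ((learnerDesign_eq_iff hn i j s τ).1 hs).2

/-! #### The matching columns, patterns and tables -/

/-- The matching columns of blocks `i`, `j` (as a finset of `Fin n'`). [folklore] -/
def matching (q ℓ n' : ℕ) (i j : Fin (2 ^ ℓ)) : Finset (Fin n') := univ.filter fun τ => colMatch q ℓ i j τ

include hn in
/-- **Design property**: distinct blocks match in at most `ℓ` columns. [cite: CarmosinoImpagliazzoKabanetsKolokolova2016, §3.1 (Thm. 3.3)] -/
theorem card_matching_le {i j : Fin (2 ^ ℓ)} (hij : i ≠ j) : (matching q ℓ (k * n + k) i j).card ≤ ℓ := by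
  have hdes := isNWDesign_learnerDesign q n k ℓ hn hij
  refine le_trans ?_ hdes
  -- `τ ↦ e j τ` maps the matching columns into `S_i ∩ S_j`
  refine Finset.card_le_card_of_injOn (fun τ => learnerDesign q n k ℓ hn j τ) (fun τ hτ => ?_)
    (fun τ _ τ' _ h => (learnerDesign q n k ℓ hn j).injective h)
  rw [mem_coe, matching, mem_filter] at hτ
  rw [mem_coe, mem_inter, mem_map, mem_map]
  exact ⟨⟨τ, mem_univ _, (learnerDesign_eq_iff hn i j τ τ).2 ⟨rfl, hτ.2⟩⟩, ⟨τ, mem_univ _, rfl⟩⟩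

/-- The rank of column `τ` among the matching columns: the number of matching columns before it.
[folklore] -/
def rank (q ℓ : ℕ) (i j : Fin (2 ^ ℓ)) (τ : ℕ) : ℕ :=
  ((range τ).filter fun τ' => colMatch q ℓ i j τ').card

/-- The matching pattern of `x` read as a number: bit `rank τ` is `x τ` for matching `τ`
(`bitsToNat` of the matching bits in column order). [folklore] -/
def idxOf (q ℓ n' : ℕ) (i j : Fin (2 ^ ℓ)) (x : Fin n' → Bool) : ℕ :=
  bitsToNat (((List.finRange n').filter fun τ : Fin n' => decide (colMatch q ℓ i j (τ : ℕ))).map x)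

/-- The input of block `j` under the pattern number `c`: bit `rank τ` of `c` on matching columns,
`z` elsewhere. [cite: CarmosinoImpagliazzoKabanetsKolokolova2016, §2.4 (preprocessing, step 4)] -/
def patInput (q ℓ : ℕ) {m n' : ℕ} (e : Fin (2 ^ ℓ) → (Fin n' ↪ Fin m)) (i j : Fin (2 ^ ℓ))
    (z : Fin m → Bool) (c : ℕ) : Fin n' → Bool :=
  fun τ => if colMatch q ℓ i j τ then c.testBit (rank q ℓ i j τ) else z (e j τ)

/-! #### Bits of `bitsToNat`, positions in sorted lists -/

omit [Fact q.Prime] in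
/-- Bit `p` of `c` is entry `p` of the numeral `encodeNat c`. [folklore] -/
theorem testBit_eq_getD_encodeNat (c p : ℕ) : c.testBit p = (encodeNat c).getD p false := by
  conv_lhs => rw [← bitsToNat_encodeNat c]
  exact Com.testBit_bitsToNat _ _

omit [Fact q.Prime] in
/-- In a strictly increasing list, an element sits right after the elements below it. [folklore] -/
theorem get_length_filter_lt {α : Type*} [LinearOrder α] : ∀ (l : List α), l.Pairwise (· < ·) →
    ∀ a ∈ l, ∃ h : (l.filter fun b => decide (b < a)).length < l.length,
      l[(l.filter fun b => decide (b < a)).length] = a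
  | [], _, a, ha => by simp at ha
  | b :: l, hs, a, ha => by
    rw [List.pairwise_cons] at hs
    rcases List.mem_cons.1 ha with rfl | ha'
    · have hnil : ((a :: l).filter fun b => decide (b < a)) = [] := by
        rw [List.filter_eq_nil_iff]
        intro c hc
        rcases List.mem_cons.1 hc with rfl | hc'
        · simp
        · have := hs.1 c hc'; simp only [decide_eq_true_eq, not_lt]; exact this.le
      refine ⟨by rw [hnil]; simp, ?_⟩
      simp only [hnil, List.length_nil, List.getElem_cons_zero]
    · have hba : b < a := hs.1 a ha'
      obtain ⟨h, hget⟩ := get_length_filter_lt l hs.2 a ha'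
      have hcons : ((b :: l).filter fun c => decide (c < a)) = b :: l.filter fun c => decide (c < a) := by
        rw [List.filter_cons_of_pos (by simpa using hba)]
      refine ⟨by rw [hcons]; simpa using h, ?_⟩
      simp only [hcons, List.length_cons, List.getElem_cons_succ, hget]

/-- The matching columns as a sorted list. [folklore] -/
def matchingList (q ℓ n' : ℕ) (i j : Fin (2 ^ ℓ)) : List (Fin n') :=
  (List.finRange n').filter fun τ : Fin n' => decide (colMatch q ℓ i j (τ : ℕ))

omit [Fact q.Prime] in
/-- The matching list enumerates the matching finset. [folklore] -/
theorem length_matchingList (i j : Fin (2 ^ ℓ)) (n' : ℕ) :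
    (matchingList q ℓ n' i j).length = (matching q ℓ n' i j).card := by
  rw [matchingList, matching, ← List.toFinset_card_of_nodup ((List.nodup_finRange n').filter _)]
  congr 1
  ext τ
  simp

omit [Fact q.Prime] in
/-- The elements of the matching list below `τ` are `rank τ` many. [folklore] -/
theorem length_filter_matchingList_lt (i j : Fin (2 ^ ℓ)) {n' : ℕ} (τ : Fin n') :
    ((matchingList q ℓ n' i j).filter fun b => decide (b < τ)).length = rank q ℓ i j τ := by
  rw [matchingList, List.filter_filter, rank,
    ← List.toFinset_card_of_nodup ((List.nodup_finRange n').filter _)]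
  -- compare the two finsets through `Fin.val`
  rw [← Finset.card_map Fin.valEmbedding]
  congr 1
  ext t
  simp only [Finset.mem_map, List.mem_toFinset, List.mem_filter, List.mem_finRange, true_and,
    Bool.and_eq_true, decide_eq_true_eq, Fin.valEmbedding_apply, Finset.mem_filter,
    Finset.mem_range]
  constructor
  · rintro ⟨σ, ⟨h1, h2⟩, rfl⟩
    exact ⟨h1, h2⟩
  · rintro ⟨h1, h2⟩
    exact ⟨⟨t, lt_trans h1 τ.isLt⟩, ⟨h1, h2⟩, rfl⟩

omit [Fact q.Prime] in
/-- **Reading the pattern number**: for a matching column `τ`, bit `rank τ` of `idxOf x` is `x τ`.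
[folklore] -/
theorem testBit_idxOf {n' : ℕ} (i j : Fin (2 ^ ℓ)) (x : Fin n' → Bool) (τ : Fin n')
    (hτ : colMatch q ℓ i j τ) : (idxOf q ℓ n' i j x).testBit (rank q ℓ i j τ) = x τ := by
  have hmem : τ ∈ matchingList q ℓ n' i j := by
    simp [matchingList, hτ]
  have hsorted : (matchingList q ℓ n' i j).Pairwise (· < ·) :=
    (List.pairwise_lt_finRange n').filter _
  obtain ⟨h, hget⟩ := get_length_filter_lt _ hsorted τ hmem
  rw [idxOf, Com.testBit_bitsToNat, ← matchingList, ← length_filter_matchingList_lt i j τ,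
    List.getD_eq_getElem _ _ (by simpa using h), List.getElem_map, hget]

omit [Fact q.Prime] in
/-- **The pattern of `x` reproduces the mixed input**: `patInput (idxOf x) = mixInput x`.
[cite: CarmosinoImpagliazzoKabanetsKolokolova2016, §2.4 (table lookup)] -/
theorem patInput_idxOf {m n' : ℕ} (e : Fin (2 ^ ℓ) → (Fin n' ↪ Fin m)) (i j : Fin (2 ^ ℓ))
    (z : Fin m → Bool) (x : Fin n' → Bool) :
    patInput q ℓ e i j z (idxOf q ℓ n' i j x) = mixInput q ℓ e i j z x := by
  funext τ
  simp only [patInput, mixInput]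
  split_ifs with h
  · exact testBit_idxOf i j x τ h
  · rfl

omit [Fact q.Prime] in
/-- The pattern number is below `2^{#matching}`. [folklore] -/
theorem idxOf_lt {n' : ℕ} (i j : Fin (2 ^ ℓ)) (x : Fin n' → Bool) :
    idxOf q ℓ n' i j x < 2 ^ (matching q ℓ n' i j).card := by
  rw [← length_matchingList, idxOf, ← matchingList]
  simpa using bitsToNat_lt ((matchingList q ℓ n' i j).map x)

/-! #### The tables and the predictor read off them -/

/-- **The table of block `j`** (relative to the challenge block `i` and the seed `z`): the values
of `g` (= `AMP(f)`) on the `2^{#matching}` pattern inputs.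
[cite: CarmosinoImpagliazzoKabanetsKolokolova2016, §2.4 (preprocessing, step 4: "build the table `T`")] -/
def tableList {m n' : ℕ} (e : Fin (2 ^ ℓ) → (Fin n' ↪ Fin m)) (g : (Fin n' → Bool) → Bool) (q : ℕ)
    (i j : Fin (2 ^ ℓ)) (z : Fin m → Bool) : List Bool :=
  List.ofFn fun c : Fin (2 ^ (matching q ℓ n' i j).card) => g (patInput q ℓ e i j z c)

omit [Fact q.Prime] in
/-- **Table lookup at the pattern of `x` returns `g` on the mixed input.**
[cite: CarmosinoImpagliazzoKabanetsKolokolova2016, §2.4 (circuit construction, step 2)] -/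
theorem tableList_getD_idxOf {m n' : ℕ} (e : Fin (2 ^ ℓ) → (Fin n' ↪ Fin m))
    (g : (Fin n' → Bool) → Bool) (i j : Fin (2 ^ ℓ)) (z : Fin m → Bool) (x : Fin n' → Bool) :
    (tableList e g q i j z).getD (idxOf q ℓ n' i j x) false = g (mixInput q ℓ e i j z x) := by
  rw [tableList, List.getD_eq_getElem _ _ (by simpa using idxOf_lt i j x), List.getElem_ofFn,
    ← patInput_idxOf e i j z x]

/-- **The NW predictor read off the tables** (CIKK §2.4, circuit construction): the hybrid bits
are table look-ups for `j < i` and advice bits for `j ≥ i`; the answer is `w i` if the test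
accepts, `¬ w i` otherwise. [cite: CarmosinoImpagliazzoKabanetsKolokolova2016, §2.4 (circuit construction, steps 1–3)] -/
def predictOfTables (D : (Fin (2 ^ ℓ) → Bool) → Bool) (i : Fin (2 ^ ℓ))
    (tbl : Fin (2 ^ ℓ) → List Bool) (idx : Fin (2 ^ ℓ) → ℕ) (w : Fin (2 ^ ℓ) → Bool) : Bool :=
  let hyb : Fin (2 ^ ℓ) → Bool := fun j => if (j : ℕ) < i then (tbl j).getD (idx j) false else w j
  if D hyb = true then w i else !(w i)

/-- **The NW predictor of the learner is `predictOfTables`** with the tables `tableList` and the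
indices `idxOf` (learner's design: the restriction of the completed seed to block `j` is the
mixed input). [cite: CarmosinoImpagliazzoKabanetsKolokolova2016, Thm. 2.11 (reconstruction algorithm)] -/
theorem nwPredictor_eq_predictOfTables (D : (Fin (2 ^ ℓ) → Bool) → Bool) (i : Fin (2 ^ ℓ))
    (z : Fin (q * q) → Bool) (w : Fin (2 ^ ℓ) → Bool) (x : Fin (k * n + k) → Bool)
    (g : (Fin (k * n + k) → Bool) → Bool) :
    nwPredictor (learnerDesign q n k ℓ hn) g D i z w x =
      predictOfTables D i (fun j => tableList (learnerDesign q n k ℓ hn) g q i j z)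
        (fun j => idxOf q ℓ (k * n + k) i j x) w := by
  unfold nwPredictor predictFn predictOfTables hybrid
  simp only [tableList_getD_idxOf, ← extend_comp_eq_mixInput hn]

end Tables

end Literature.Computability.Learning
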